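import Summits.Ventures.WeilGRH.UniformConductorFloorLog10TableValidA
import Summits.Ventures.WeilGRH.UniformConductorFloorLog10TableValidB
import Summits.Ventures.WeilGRH.UniformConductorFloorLog10TableValidC
import Summits.Ventures.WeilGRH.UniformConductorFloorLog10TableValidD
import Summits.Ventures.WeilGRH.UniformConductorFloorLog10TableValidE
import Summits.Ventures.WeilGRH.UniformConductorFloorLog10TableValidF
import Summits.Ventures.WeilGRH.UniformConductorFloorLog10TableValidG
import Summits.Ventures.WeilGRH.UniformConductorFloorLog10TableValidH
import HarnessLib

/-!
# GRH arm (rh-explicit, venture WeilGRH): the special-value table `Log10Table` — `tab_valid : TabValid (2^80) a ks 144 tab` (glue of the kernel parts)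

Cell `rh-explicit`, WEIL TRACK — GRH ARM (weil-grh-1 gen10; glue of the kernel parts A–H, re-cut from gen9's sequential chain so that the
parts after A import only A and file in parallel; slice width 18 at this window).  Part A certifies `P`, `A`, `C`, the prime data and the modes `0 … 19`;
the later parts certify `checkTable` slices; this file chains them with `TabValid.extend` into `tab_valid : TabValid (2^80) a ks 144 tab` — the input of
weil-grh-2's twisted cell kits (doors E/C) and of the table-based Galerkin refutation `UniformConductorFloorGalerkinTab` at this window.  No kernel
computation here; no definitions; standard axioms. [cite: Moore1966, Ch. 3 (interval arithmetic: inclusion property)]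
-/

namespace Summit.Ventures.WeilGRH.Log10Table
open Literature.NumberTheory.LFunctions Literature.NumberTheory.LFunctions.Yoshida1992 Encl Literature.Analysis.ValidatedNumerics.NumericsMP

/-- The table is valid below `38`. [cite: Moore1966, Ch. 3 (interval arithmetic: inclusion property)] -/
theorem tab_valid38 : TabValid (2 ^ 80) a ks (20 + 18) tab :=
  tab_valid20.extend fun n hn hnk ↦ idxValid_of_checkTable (prm := prm) (by norm_num [prm]) a_pos consts_valid tT20 hn hnk

/-- The table is valid below `56`. [cite: Moore1966, Ch. 3 (interval arithmetic: inclusion property)] -/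
theorem tab_valid56 : TabValid (2 ^ 80) a ks (38 + 18) tab :=
  tab_valid38.extend fun n hn hnk ↦ idxValid_of_checkTable (prm := prm) (by norm_num [prm]) a_pos consts_valid tT38 hn hnk

/-- The table is valid below `74`. [cite: Moore1966, Ch. 3 (interval arithmetic: inclusion property)] -/
theorem tab_valid74 : TabValid (2 ^ 80) a ks (56 + 18) tab :=
  tab_valid56.extend fun n hn hnk ↦ idxValid_of_checkTable (prm := prm) (by norm_num [prm]) a_pos consts_valid tT56 hn hnk

/-- The table is valid below `92`. [cite: Moore1966, Ch. 3 (interval arithmetic: inclusion property)] -/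
theorem tab_valid92 : TabValid (2 ^ 80) a ks (74 + 18) tab :=
  tab_valid74.extend fun n hn hnk ↦ idxValid_of_checkTable (prm := prm) (by norm_num [prm]) a_pos consts_valid tT74 hn hnk

/-- The table is valid below `110`. [cite: Moore1966, Ch. 3 (interval arithmetic: inclusion property)] -/
theorem tab_valid110 : TabValid (2 ^ 80) a ks (92 + 18) tab :=
  tab_valid92.extend fun n hn hnk ↦ idxValid_of_checkTable (prm := prm) (by norm_num [prm]) a_pos consts_valid tT92 hn hnk

/-- The table is valid below `128`. [cite: Moore1966, Ch. 3 (interval arithmetic: inclusion property)] -/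
theorem tab_valid128 : TabValid (2 ^ 80) a ks (110 + 18) tab :=
  tab_valid110.extend fun n hn hnk ↦ idxValid_of_checkTable (prm := prm) (by norm_num [prm]) a_pos consts_valid tT110 hn hnk

/-- The table is valid below `144`. [cite: Moore1966, Ch. 3 (interval arithmetic: inclusion property)] -/
theorem tab_valid144 : TabValid (2 ^ 80) a ks (128 + 16) tab :=
  tab_valid128.extend fun n hn hnk ↦ idxValid_of_checkTable (prm := prm) (by norm_num [prm]) a_pos consts_valid tT128 hn hnk

/-- ★ The special-value table `Log10Table.tab` is valid below `144`. [cite: Moore1966, Ch. 3 (interval arithmetic: inclusion property)] -/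
theorem tab_valid : TabValid (2 ^ 80) a ks 144 tab := tab_valid144

end Summit.Ventures.WeilGRH.Log10Table
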